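import Summits.Ventures.LatticeQCDFlow.Scaling.IdealStarMixingCeiling

/-!
HONEST FRAMING: exact (Metropolis-corrected) sampling algorithms for lattice gauge theory; figures
of merit are autocorrelation/cost numbers at stated couplings and volumes; no continuum-physics
claim.

# IdealStarTunedConstants — THE `K·log K` LAW WITH ITS CONSTANTS: FOR THE UNIFORMLY LISTED STAR (`m = cK`)
# `t_mix(ε) ≤ ⌈(2K/(t(1−t)))·log((K+1)/(tε))⌉`, AND AT THE BALANCED SWAP FRACTION `t = 1/2`
# `(2K − 1)·log(K/4) ≤ t_mix(1/4) ≤ ⌈8K·log(8(K+1))⌉` — A WINDOW OF A FACTOR FOUR (lean-2 GEN-24, ours)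

Venture-side (OURS).  Cell `lqcd-flow` (pub-lqcd), unit `pub-lqcd-lean-2-g24`, 2026-08-27.  Chapter L (the coupon-collector
law from a cold start), file 22: the two-sided law of `Scaling/IdealStarMixingCeiling` read with explicit constants.  When
every hub edge `{0,k}` is listed exactly `c` times (`m = cK`) the allocation drops out of the ceiling; at `t = 1/2` the
floor `(K/t − 1)·log(K/4)` and the ceiling `⌈(2m/(t(1−t)c))·log((K+1)/(tε))⌉` are `(2K−1)·log(K/4)` and `⌈8K·log(8(K+1))⌉`:
the same order `K·log K`, leading constants `2` and `8`.

## What is proved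

* **`idealStar_mixingTime_le_uniform`** — `m = cK`: `t_mix(ε) ≤ ⌈(2K/(t(1−t)))·log((K+1)/(tε))⌉`.
* **`idealStar_mixingTime_two_sided_half`** — `m = cK`, `t = 1/2`, `K ≥ 2`, a start with `Σ_k ν(x_{k+1}) ≤ 1/4`:
  `(2K − 1)·log(K/4) ≤ t_mix(1/4) ≤ ⌈8K·log(8(K+1))⌉`; **`_of_card`** supplies the start when `|S| ≥ 4K`.
* **`idealStar_swapBudget_le_half`** — at `t = 1/2` the expected number of swap PROPOSALS before `1/4`-mixing,
  `t·t_mix(1/4)`, is `≤ ⌈8K·log(8(K+1))⌉/2`, against the floor `t·t_mix(1/4) ≥ (K − 1/2)·log(K/4)` of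
  `Scaling/HubCollectorLaw` (`hotOnlyHub_swapBudget_ge`).

NOT CLAIMED: the optimal `t` (the ceiling's `1/(t(1−t))` and the floor's `1/t` disagree on the `t → 1` side: at `t`
near one the hot sampler is starved, which the collector floor does not see); cutoff.
Literature grade (cell rule): OWN COROLLARIES; nothing cited as a fact; no new bib keys.
-/

noncomputable section

open Finset Function
open Literature.Probability.MarkovChains

namespace Summit.Ventures.LatticeQCDFlow.Scaling

variable {S : Type*} [Fintype S] [DecidableEq S]

section Tuned
variable {K m : ℕ} {ν : S → ℝ} {M : Fin (K + 1) → S → S → ℝ} {t : ℝ} (κ : Fin m → Fin K)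

/-- **UNIFORM LISTING (`m = cK`): `t_mix(ε) ≤ ⌈(2K/(t(1−t)))·log((K+1)/(tε))⌉`.** [ours] -/
theorem idealStar_mixingTime_le_uniform (ht0 : 0 < t) (ht1 : t < 1) (hν : ∀ v, 0 < ν v) (hν1 : ∑ v, ν v = 1)
    (hM : ∀ k, IsRowStochastic (M k)) (hM0 : ∀ u v, M 0 u v = ν v) {c : ℕ} (hc1 : 1 ≤ c) (hK : 1 ≤ K)
    (hc : ∀ p : Fin K, c ≤ (univ.filter (fun r : Fin m => κ r = p)).card) (hmc : m = c * K) {ε : ℝ} (hε : 0 < ε) :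
    mixingTime (fun y z : Fin (K + 1) → S => t * ptGraphSwap (fun _ : Fin (K + 1) => ν)
          (fun r : Fin m => (((0 : Fin (K + 1)), (κ r).succ) : Fin (K + 1) × Fin (K + 1))) (fun _ => Equiv.refl S) y z
          + (1 - t) * prodKernel (fun k : Fin (K + 1) => if k = 0 then (1 : ℝ) else 0) M y z)
        (tensorFun (fun _ : Fin (K + 1) => ν)) ε
      ≤ ⌈2 * (K : ℝ) / (t * (1 - t)) * Real.log (((K : ℝ) + 1) / (t * ε))⌉₊ := by
  have hm : 1 ≤ m := by rw [hmc]; exact Nat.one_le_iff_ne_zero.mpr (Nat.mul_ne_zero (by omega) (by omega))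
  have hcm : c ≤ m := by rw [hmc]; exact Nat.le_mul_of_pos_right c (by omega)
  have h := idealStar_mixingTime_le κ hm ht0 ht1 hν hν1 hM hM0 hc1 hc hcm hε
  have hcpos : (0 : ℝ) < c := Nat.cast_pos.mpr (by omega)
  have e : 2 * (m : ℝ) / (t * (1 - t) * c) = 2 * (K : ℝ) / (t * (1 - t)) := by
    rw [hmc, Nat.cast_mul]
    field_simp
  rwa [e] at h

/-- **THE BALANCED STAR (`m = cK`, `t = 1/2`, `K ≥ 2`): `(2K − 1)·log(K/4) ≤ t_mix(1/4) ≤ ⌈8K·log(8(K+1))⌉`** — both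
sides of order `K·log K`, constants `2` and `8`. [ours] -/
theorem idealStar_mixingTime_two_sided_half (hK : 2 ≤ K) (hν : ∀ v, 0 < ν v) (hν1 : ∑ v, ν v = 1)
    (hM : ∀ k, IsRowStochastic (M k)) (hMrev : ∀ k, DetailedBalance ν (M k)) (hM0 : ∀ u v, M 0 u v = ν v) {c : ℕ}
    (hc1 : 1 ≤ c) (hc : ∀ p : Fin K, c ≤ (univ.filter (fun r : Fin m => κ r = p)).card) (hmc : m = c * K)
    (x : Fin (K + 1) → S) (hx : ∑ k : Fin K, ν (x k.succ) ≤ 1 / 4) :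
    (2 * (K : ℝ) - 1) * Real.log (K / 4)
        ≤ (mixingTime (fun y z : Fin (K + 1) → S => 1 / 2 * ptGraphSwap (fun _ : Fin (K + 1) => ν)
            (fun r : Fin m => (((0 : Fin (K + 1)), (κ r).succ) : Fin (K + 1) × Fin (K + 1))) (fun _ => Equiv.refl S) y z
            + (1 - 1 / 2) * prodKernel (fun k : Fin (K + 1) => if k = 0 then (1 : ℝ) else 0) M y z)
          (tensorFun (fun _ : Fin (K + 1) => ν)) (1 / 4) : ℝ) ∧
      mixingTime (fun y z : Fin (K + 1) → S => 1 / 2 * ptGraphSwap (fun _ : Fin (K + 1) => ν)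
            (fun r : Fin m => (((0 : Fin (K + 1)), (κ r).succ) : Fin (K + 1) × Fin (K + 1))) (fun _ => Equiv.refl S) y z
            + (1 - 1 / 2) * prodKernel (fun k : Fin (K + 1) => if k = 0 then (1 : ℝ) else 0) M y z)
          (tensorFun (fun _ : Fin (K + 1) => ν)) (1 / 4)
        ≤ ⌈8 * (K : ℝ) * Real.log (8 * ((K : ℝ) + 1))⌉₊ := by
  have hm : 1 ≤ m := by rw [hmc]; exact Nat.one_le_iff_ne_zero.mpr (Nat.mul_ne_zero (by omega) (by omega))
  have hcm : c ≤ m := by rw [hmc]; exact Nat.le_mul_of_pos_right c (by omega)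
  have h := idealStar_mixingTime_two_sided κ hK hm (t := 1 / 2) (by norm_num) (by norm_num) hν hν1 hM hMrev hM0 hc1
    hc hcm x hx
  have hcpos : (0 : ℝ) < c := Nat.cast_pos.mpr (by omega)
  have e1 : ((K : ℝ) / (1 / 2) - 1) * Real.log (K / 4) = (2 * (K : ℝ) - 1) * Real.log (K / 4) := by ring
  have e2 : 2 * (m : ℝ) / (1 / 2 * (1 - 1 / 2) * c) * Real.log (((K : ℝ) + 1) / (1 / 2 * (1 / 4)))
      = 8 * (K : ℝ) * Real.log (8 * ((K : ℝ) + 1)) := by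
    rw [hmc, Nat.cast_mul]
    have e3 : ((K : ℝ) + 1) / (1 / 2 * (1 / 4)) = 8 * ((K : ℝ) + 1) := by ring
    rw [e3]
    field_simp
    ring
  rw [e1, e2] at h
  exact h

/-- **THE BALANCED STAR ON A LARGE CONFIGURATION SPACE (`|S| ≥ 4K`).** [ours] -/
theorem idealStar_mixingTime_two_sided_half_of_card (hK : 2 ≤ K) (hS : 4 * K ≤ Fintype.card S) (hν : ∀ v, 0 < ν v)
    (hν1 : ∑ v, ν v = 1) (hM : ∀ k, IsRowStochastic (M k)) (hMrev : ∀ k, DetailedBalance ν (M k))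
    (hM0 : ∀ u v, M 0 u v = ν v) {c : ℕ} (hc1 : 1 ≤ c) (hc : ∀ p : Fin K, c ≤ (univ.filter (fun r : Fin m => κ r = p)).card)
    (hmc : m = c * K) :
    (2 * (K : ℝ) - 1) * Real.log (K / 4)
        ≤ (mixingTime (fun y z : Fin (K + 1) → S => 1 / 2 * ptGraphSwap (fun _ : Fin (K + 1) => ν)
            (fun r : Fin m => (((0 : Fin (K + 1)), (κ r).succ) : Fin (K + 1) × Fin (K + 1))) (fun _ => Equiv.refl S) y z
            + (1 - 1 / 2) * prodKernel (fun k : Fin (K + 1) => if k = 0 then (1 : ℝ) else 0) M y z)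
          (tensorFun (fun _ : Fin (K + 1) => ν)) (1 / 4) : ℝ) ∧
      mixingTime (fun y z : Fin (K + 1) → S => 1 / 2 * ptGraphSwap (fun _ : Fin (K + 1) => ν)
            (fun r : Fin m => (((0 : Fin (K + 1)), (κ r).succ) : Fin (K + 1) × Fin (K + 1))) (fun _ => Equiv.refl S) y z
            + (1 - 1 / 2) * prodKernel (fun k : Fin (K + 1) => if k = 0 then (1 : ℝ) else 0) M y z)
          (tensorFun (fun _ : Fin (K + 1) => ν)) (1 / 4)
        ≤ ⌈8 * (K : ℝ) * Real.log (8 * ((K : ℝ) + 1))⌉₊ := by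
  obtain ⟨x, hx⟩ := exists_rare_coldStart (μ := fun _ : Fin (K + 1) => ν) (fun _ => hν1) hS
  exact idealStar_mixingTime_two_sided_half κ hK hν hν1 hM hMrev hM0 hc1 hc hmc x hx

/-- **THE SWAP BUDGET OF THE BALANCED STAR:** at `t = 1/2`, `m = cK`, the expected number of swap proposals issued
before `1/4`-mixing, `t·t_mix(1/4)`, satisfies **`(K − 1/2)·log(K/4) ≤ t·t_mix(1/4) ≤ ⌈8K·log(8(K+1))⌉/2`**. [ours] -/
theorem idealStar_swapBudget_two_sided_half (hK : 2 ≤ K) (hν : ∀ v, 0 < ν v) (hν1 : ∑ v, ν v = 1)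
    (hM : ∀ k, IsRowStochastic (M k)) (hMrev : ∀ k, DetailedBalance ν (M k)) (hM0 : ∀ u v, M 0 u v = ν v) {c : ℕ}
    (hc1 : 1 ≤ c) (hc : ∀ p : Fin K, c ≤ (univ.filter (fun r : Fin m => κ r = p)).card) (hmc : m = c * K)
    (x : Fin (K + 1) → S) (hx : ∑ k : Fin K, ν (x k.succ) ≤ 1 / 4) :
    ((K : ℝ) - 1 / 2) * Real.log (K / 4)
        ≤ 1 / 2 * (mixingTime (fun y z : Fin (K + 1) → S => 1 / 2 * ptGraphSwap (fun _ : Fin (K + 1) => ν)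
            (fun r : Fin m => (((0 : Fin (K + 1)), (κ r).succ) : Fin (K + 1) × Fin (K + 1))) (fun _ => Equiv.refl S) y z
            + (1 - 1 / 2) * prodKernel (fun k : Fin (K + 1) => if k = 0 then (1 : ℝ) else 0) M y z)
          (tensorFun (fun _ : Fin (K + 1) => ν)) (1 / 4) : ℝ) ∧
      1 / 2 * (mixingTime (fun y z : Fin (K + 1) → S => 1 / 2 * ptGraphSwap (fun _ : Fin (K + 1) => ν)
            (fun r : Fin m => (((0 : Fin (K + 1)), (κ r).succ) : Fin (K + 1) × Fin (K + 1))) (fun _ => Equiv.refl S) y z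
            + (1 - 1 / 2) * prodKernel (fun k : Fin (K + 1) => if k = 0 then (1 : ℝ) else 0) M y z)
          (tensorFun (fun _ : Fin (K + 1) => ν)) (1 / 4) : ℝ)
        ≤ (⌈8 * (K : ℝ) * Real.log (8 * ((K : ℝ) + 1))⌉₊ : ℝ) / 2 := by
  obtain ⟨hlo, hhi⟩ := idealStar_mixingTime_two_sided_half κ hK hν hν1 hM hMrev hM0 hc1 hc hmc x hx
  have hhi' : (mixingTime (fun y z : Fin (K + 1) → S => 1 / 2 * ptGraphSwap (fun _ : Fin (K + 1) => ν)
            (fun r : Fin m => (((0 : Fin (K + 1)), (κ r).succ) : Fin (K + 1) × Fin (K + 1))) (fun _ => Equiv.refl S) y z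
            + (1 - 1 / 2) * prodKernel (fun k : Fin (K + 1) => if k = 0 then (1 : ℝ) else 0) M y z)
          (tensorFun (fun _ : Fin (K + 1) => ν)) (1 / 4) : ℝ) ≤ (⌈8 * (K : ℝ) * Real.log (8 * ((K : ℝ) + 1))⌉₊ : ℝ) := by
    exact_mod_cast hhi
  constructor
  · have e : ((K : ℝ) - 1 / 2) * Real.log (K / 4) = 1 / 2 * ((2 * (K : ℝ) - 1) * Real.log (K / 4)) := by ring
    rw [e]
    linarith
  · linarith

end Tuned

end Summit.Ventures.LatticeQCDFlow.Scaling

end
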